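import Summits.HodgeConjecture.HodgeConjecture.Cruxes.BlochSeedDiscOne.AxisPhaseTorus
import Summits.HodgeConjecture.HodgeConjecture.Cruxes.BlochSeedDiscOne.LinePhaseTorus
import Summits.HodgeConjecture.HodgeConjecture.Cruxes.BlochSeedDiscOne.PhaseTorusLawN13

/-!
# The AXIS-ROOM PHASE-TORUS LAW at its METHOD CEILING `rank ≤ 21` (strengthen g20; corollaries of `PhaseTorusLawN13`)

HONESTY LABEL. Nothing in this file is a theorem toward HC / HC_CM / HC_AV / №4 / 26512 / 18881 / H2; it proves no rung and closes no shell of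
`SPlus 14 sigmaH 0`. It is kernel-checked evidence for the strengthen lens (an S⁺ whose proof is a FINITE LETTER CALCULUS on the phase torus).

CONTENT. `AxisPhaseTorus.lean` (g19, v1.3) proved every statement of the axis-room law from a corank-`γ` phase-torus law `PhaseTorusLawN γ` and
instantiated it at the then-best kernel value `γ = 10` (`rank ≤ 18`, inhabitant `≥ 11 ∕ ≥ 11` classes, `rank ≥ 19`), recording the window
`10 ≤ γ* ≤ 13`.  `PhaseTorusLawN13.phaseTorusLawN_thirteen` (g20) closes the window at `γ* = 13 ∕ 14`; this file re-instantiates: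
* §1 `hf_mu_eq_zero_21` / `axisRoom_mu_eq_zero_21` / `pairAxis_mu_eq_zero_21`: **`rank ≤ 21 ⇒ μ = 0`** in the (relaxed / pair-) axis room of the
  door of record, every height, no budget; the rank floor `22` of an inhabitant (`hf_rank_ge_22`, `axisRoom_rank_ge_22`); the inhabitant shape
  `≥ 14` positive classes, `≥ 14` negative classes, `rank ≥ #{ω>0} + 8` (`hf_inhabitant_shape_14`); the `SPlusB` readings at `rank ≤ 21`.
* §2 the METHOD CEILING typed as a theorem: `law_input_iff : PhaseTorusLawN γ ↔ γ ≤ 13` — the torus input of this road is exhausted, `21` is final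
  for `hf_mu_eq_zero_of_law`.
* §3 `LinePhaseTorus.lineTwoTermUp13_mu_eq_zero`: the UP law for integer clean LINE designs with its torus hypothesis discharged up to corank `13`.
-/

set_option linter.dupNamespace false
set_option autoImplicit false

namespace Summit.HodgeConjecture.HodgeConjecture.Cruxes.BlochSeedDiscOne.AxisPhaseTorus

open Summit.HodgeConjecture.HodgeConjecture.Cruxes.BlochSeedDiscOne.DepthBoundA4
open Summit.HodgeConjecture.HodgeConjecture.Cruxes.BlochSeedDiscOne.HallB136 (HallUp)
open Summit.HodgeConjecture.HodgeConjecture.Cruxes.BlochSeedDiscOne.RuleDPlate (HallPlusUp)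
open Summit.HodgeConjecture.HodgeConjecture.Cruxes.BlochSeedDiscOne.RingTwoMassLaw.ClassLaw (E)
open Summit.HodgeConjecture.HodgeConjecture.Cruxes.BlochSeedDiscOne.ShellThreePairLaw
open Summit.HodgeConjecture.HodgeConjecture.Cruxes.BlochSeedDiscOne.PhaseTorus
  (PT PhaseTorusLawN phaseTorusLawN_thirteen phaseTorusLawN_iff not_phaseTorusLawN_fourteen)

/-! ## §1 The relaxed room and the axis room at rank ≤ 21 -/

/-- **rank ≤ 21** in the relaxed room (`AxisRoomHF`, `E = 0`, (A1), `HallPlusUp 8`): `μ = 0`. -/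
theorem hf_mu_eq_zero_21 {h : ℤ} {D : Design} (hD : D.OnAlphabet h) (hR : AxisRoomHF D) (hE : E h D = 0) (h1 : D.A1)
    (hH8 : HallPlusUp D 8) (hr : D.rank ≤ 21) : D.mu = 0 :=
  hf_mu_eq_zero_of_law hD hR hE h1 hH8 phaseTorusLawN_thirteen (by simpa using hr)

/-- **THE AXIS-ROOM PHASE-TORUS LAW AT RANK ≤ 21** (every height, no budget, no `RuleD`, no `Disj`, no `HallUp`, no flow data). -/
theorem axisRoom_mu_eq_zero_21 {h : ℤ} {D : Design} (hD : D.OnAlphabet h) (hR : AxisRoom D) (h1 : D.A1)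
    (hH8 : HallPlusUp D 8) (hr : D.rank ≤ 21) : D.mu = 0 :=
  hf_mu_eq_zero_21 hD (axisRoomHF_of_axisRoom hR) (E_eq_zero_of_axisRoom hD h1 hR) h1 hH8 hr

/-- the pair-axis relaxed room at rank ≤ 21. -/
theorem pairAxis_mu_eq_zero_21 {h : ℤ} {D : Design} (hD : D.OnAlphabet h) (hR : AxisRoomHF D) {g g' : Fin 4} (hne : g ≠ g')
    (hPA : PairAxisRoom g g' D) (h1 : D.A1) (hH8 : HallPlusUp D 8) (hr : D.rank ≤ 21) : D.mu = 0 :=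
  hf_mu_eq_zero_21 hD hR (E_eq_zero_of_pairAxisRoom hD h1 hne hPA) h1 hH8 hr

/-- **RANK FLOOR 22**: an inhabitant of the door of record in the relaxed axis room has `rank ≥ 22`. -/
theorem hf_rank_ge_22 {h : ℤ} {D : Design} (hD : D.OnAlphabet h) (hR : AxisRoomHF D) (hE : E h D = 0) (h1 : D.A1)
    (hH8 : HallPlusUp D 8) (hμ : D.mu ≠ 0) : 22 ≤ D.rank := by
  by_contra hlt
  exact hμ (hf_mu_eq_zero_21 hD hR hE h1 hH8 (by omega))

theorem axisRoom_rank_ge_22 {h : ℤ} {D : Design} (hD : D.OnAlphabet h) (hR : AxisRoom D) (h1 : D.A1)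
    (hH8 : HallPlusUp D 8) (hμ : D.mu ≠ 0) : 22 ≤ D.rank :=
  hf_rank_ge_22 hD (axisRoomHF_of_axisRoom hR) (E_eq_zero_of_axisRoom hD h1 hR) h1 hH8 hμ

/-- **THE SHAPE OF AN INHABITANT (final form)**: `μ ≠ 0` forces at least FOURTEEN positive classes, at least FOURTEEN negative classes,
and `rank ≥ #{ω > 0} + 8 ≥ 22`. -/
theorem hf_inhabitant_shape_14 {h : ℤ} {D : Design} (hD : D.OnAlphabet h) (hR : AxisRoomHF D) (hE : E h D = 0) (h1 : D.A1)
    (hH8 : HallPlusUp D 8) (hμ : D.mu ≠ 0) :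
    14 ≤ (posCl D).card ∧ 14 ≤ (negCl D).card ∧ ((posCl D).card : ℤ) + 8 ≤ D.rank := by
  classical
  have hpos : 14 ≤ (posCl D).card := by
    by_contra hc
    exact hμ (mu_eq_zero_of_few_posClasses hD hR hE h1 phaseTorusLawN_thirteen (posCl D) (by omega) not_mem_posCl)
  have hneg : 14 ≤ (negCl D).card := by
    by_contra hc
    exact hμ (mu_eq_zero_of_few_negClasses hD hR hE h1 phaseTorusLawN_thirteen (negCl D) (by omega) not_mem_negCl)
  exact ⟨hpos, hneg, (hf_inhabitant_shape hD hR hE h1 hH8 hμ).2.2⟩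

theorem axisRoom_inhabitant_shape_14 {h : ℤ} {D : Design} (hD : D.OnAlphabet h) (hR : AxisRoom D) (h1 : D.A1)
    (hH8 : HallPlusUp D 8) (hμ : D.mu ≠ 0) :
    14 ≤ (posCl D).card ∧ 14 ≤ (negCl D).card ∧ ((posCl D).card : ℤ) + 8 ≤ D.rank :=
  hf_inhabitant_shape_14 hD (axisRoomHF_of_axisRoom hR) (E_eq_zero_of_axisRoom hD h1 hR) h1 hH8 hμ

/-- **room-of-record reading at rank ≤ 21**: the `SPlusB` sentence restricted to the axis room (every shell, every budget). -/
theorem sPlusB_axisRoom_rank_le_21 (h : ℤ) (Budget : Design → Prop) :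
    ∀ D : Design, D.OnAlphabet h → LeggedFloor.Disj D → D.A1 → LeggedFloor.RuleD D → HallUp D → HallPlusUp D 8 → D.mu ≠ 0 →
      Budget D → AxisRoom D → D.rank ≤ 21 → False :=
  fun _ hD _ h1 _ _ hH8 hμ _ hR hr => hμ (axisRoom_mu_eq_zero_21 hD hR h1 hH8 hr)

theorem sPlusB_axisRoomHF_rank_le_21 (h : ℤ) (Budget : Design → Prop) :
    ∀ D : Design, D.OnAlphabet h → LeggedFloor.Disj D → D.A1 → LeggedFloor.RuleD D → HallUp D → HallPlusUp D 8 → D.mu ≠ 0 →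
      Budget D → AxisRoomHF D → E h D = 0 → D.rank ≤ 21 → False :=
  fun _ hD _ h1 _ _ hH8 hμ _ hR hE hr => hμ (hf_mu_eq_zero_21 hD hR hE h1 hH8 hr)

/-! ## §2 The method ceiling, typed: the torus input is exhausted at `γ = 13` -/

/-- **THE METHOD CEILING.** The only input of `hf_mu_eq_zero_of_law` that varies is `PhaseTorusLawN γ`, and `PhaseTorusLawN γ ↔ γ ≤ 13`:
the theorem `hf_mu_eq_zero_of_law` can be instantiated exactly for `rank ≤ γ + 8 ≤ 21`, never beyond. (This does NOT say `μ ≠ 0` occurs at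
rank `22` in the axis room — the torus witness `omega14` is a class MEASURE, not a design; whether a design realises it is untouched here.) -/
theorem law_input_iff (γ : ℕ) : PhaseTorusLawN γ ↔ γ ≤ 13 := phaseTorusLawN_iff γ

theorem law_road_ceiling : (∀ γ, γ ≤ 13 → PhaseTorusLawN γ) ∧ (∀ γ, 14 ≤ γ → ¬ PhaseTorusLawN γ) :=
  ⟨fun γ h => (phaseTorusLawN_iff γ).2 h, fun γ h hl => by have := (phaseTorusLawN_iff γ).1 hl; omega⟩

end Summit.HodgeConjecture.HodgeConjecture.Cruxes.BlochSeedDiscOne.AxisPhaseTorus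

namespace Summit.HodgeConjecture.HodgeConjecture.Cruxes.BlochSeedDiscOne.LinePhaseTorus

open Finset BigOperators Summit.Ventures.HSemireg Summit.Ventures.HSemireg.Pad4Tower
open Summit.HodgeConjecture.HodgeConjecture.Cruxes.BlochSeedDiscOne.PhaseTorus (phaseTorusLawN_thirteen)

/-! ## §3 The UP law for integer clean LINE designs, unconditionally up to corank 13 -/

/-- **the UP law at corank ≤ 13, unconditional** (`lineTwoTermUp_mu_eq_zero_of_law 13` with its torus hypothesis DISCHARGED by
`phaseTorusLawN_thirteen`): an integer clean LINE design with a two-term cokernel presentation of corank `≤ 13` carries no Weil moment. -/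
theorem lineTwoTermUp13_mu_eq_zero (h : ℤ) (C : MConfig) (mN mP : MCell → ℤ)
    (hmN : ∀ Z, 0 ≤ mN Z) (hmP : ∀ P, 0 ≤ mP P)
    (hline : ∀ Z ∈ C.lower ∪ C.upper, LineCell h Z) (hA1 : ClassScreen (C.wch mN mP))
    (F : UpFlow C mN mP) (hrank : (∑ Z ∈ C.lower, mN Z) - (∑ P ∈ C.upper, mP P) ≤ 13) :
    C.wch mN mP eWord = 0 :=
  lineTwoTermUp_mu_eq_zero_of_law 13 (fun ω A hA hω hK => phaseTorusLawN_thirteen ω A hA hω hK) h C mN mP hmN hmP hline hA1 F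
    (by exact_mod_cast hrank)

end Summit.HodgeConjecture.HodgeConjecture.Cruxes.BlochSeedDiscOne.LinePhaseTorus
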